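import Literature.AlgebraicGeometry.Motives.HodgeThetaSubalgebraUnitaryRaisingRankPsi
import HarnessLib

/-!
# The `Θ`-subalgebra theorem for unitary multiplicities `(4, b)`, `b` odd — complex–Hermitian core
# (Ribet 1983, Thm. 3 at `(n′, n″) = (4, n″)`, `n″` odd: every odd dimension `g ≥ 5` with `k` acting by `(4, g − 4)`)

Family `hodge`, layer `Literature/AlgebraicGeometry/Motives` (pure linear algebra over `ℂ`; no geometry). Research
context: cell `pub-hodge-ring2` (HONEST FRAMING: research route conditional on HC_CM; not a corollary; Q11.4-sentence-2
already refuted in dim ≥ 3), Literature lane gen 83, programme R65. UNCONDITIONAL; theorems only, no definition, no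
named fact (D-0026), no `sorry`. The FAMILY version of `HodgeThetaSubalgebraUnitaryFourCoprimeCore` ((4,7), (4,11)) and
`…UnitaryCoprimeStep` ((4,5)): with BOTH raising-rank lemmas — the Φ-route `exists_raise_rank_gt_of_two_le` (rank 2 by the
`(2 | odd)` core; rank 3 by the `(3 | 3∤·)` core when `3 ∤ b`) and the Ψ-route `exists_raise_rank_gt_of_finrank_eq_succ`
(rank 3 when `3 ∣ b`, by counting: `b > 6`) — the rank-four raising lemma holds for EVERY odd `b ≥ 5`, and the generic
step `UnitaryCoprimeStep.eq_top_of_onto_of_core` runs the induction `(4 | b − 4) ⟹ (4 | b)` down to `(4|1)`, `(4|3)`.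

THE PRINTED THEOREM. Ribet, Amer. J. Math. 105 (1983), Thm. 3 = Gordon's survey Thm. 6.3 (3) [held
`paper:arxiv-alg-geom_9709030` p. 18]: `End⁰ = k` imaginary quadratic, coprime multiplicities `(n′, n″)` ⟹ `Hg = U(V,φ)`,
`B•(Xⁿ) = D•(Xⁿ)`. Here `(n′, n″) = (4, odd)`.

* §1 **`UnitaryFourOdd.exists_raise_onto_four`** — `dim P = 4`, `dim Q ≥ 5` odd ⟹ a raising operator onto `P`.
* §2 **`UnitaryFourOdd.eq_top`, `eq_top'`** — the `(4 | odd)` and `(odd | 4)` cores.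

## References
* [Ribet1983] K. A. Ribet, Amer. J. Math. 105 (1983), Thm. 3.
* [Gordon1997] B. B. Gordon, *A survey of the Hodge conjecture for abelian varieties*, Thm. 6.3 (3), pp. 18–19.
* [Deligne1982HodgeCycles] P. Deligne, LNM 900 (1982), I §3 Prop. 3.4, 3.6.
* [GoodmanWallachGTM255] R. Goodman, N. R. Wallach, GTM 255 (2009), §4.1.1.
-/

noncomputable section

namespace Literature.AlgebraicGeometry.Motives

namespace HodgeStructure

section RankFour

universe u

variable {W : Type u} [AddCommGroup W] [Module ℂ W]

/-! ### §1 A raising operator onto `P` (`dim P = 4`, `dim Q` odd `≥ 5`) -/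

/-- **The rank-four raising lemma for `(4 | b)`, `b` odd, `b ≥ 5`.** [cite: Ribet1983, Thm. 3] [cite: Gordon1997, Thm. 6.3 (3)]
[cite: Deligne1982HodgeCycles, I §3 Prop. 3.6] -/
theorem UnitaryFourOdd.exists_raise_onto_four [FiniteDimensional ℂ W] {𝔊 : Submodule ℂ (Module.End ℂ W)}
    (hbr : ∀ Y ∈ 𝔊, ∀ Z ∈ 𝔊, Y * Z - Z * Y ∈ 𝔊)
    (hirr : ∀ U : Submodule ℂ W, (∀ A ∈ 𝔊, ∀ u ∈ U, A u ∈ U) → U = ⊥ ∨ U = ⊤)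
    {Θ : Module.End ℂ W} (hΘ : Θ ∈ 𝔊) (hΘΘ : Θ * Θ = 1)
    {P Q : Submodule ℂ W} (hP : ∀ x, x ∈ P ↔ Θ x = x) (hQ : ∀ x, x ∈ Q ↔ Θ x = -x)
    (hP4 : Module.finrank ℂ P = 4) (hQodd : Odd (Module.finrank ℂ Q)) (hQ5 : 5 ≤ Module.finrank ℂ Q)
    {s : W → W → ℂ} (hadd : ∀ x y z, s (x + y) z = s x z + s y z) (hsymm : ∀ x y, s y x = starRingEnd ℂ (s x y))
    (hPQ : ∀ p ∈ P, ∀ q ∈ Q, s p q = 0) (hdefP : ∀ p ∈ P, s p p = 0 → p = 0) (hdefQ : ∀ q ∈ Q, s q q = 0 → q = 0)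
    (hadj : ∀ X ∈ 𝔊, ∃ Y ∈ 𝔊, ∀ x y, s (X x) y = s x (Y y)) :
    ∃ B ∈ 𝔊, Θ * B = B ∧ B * Θ = -B ∧ ∀ p ∈ P, ∃ w, B w = p := by
  classical
  have hraiseval : ∀ Z : Module.End ℂ W, Θ * Z = Z → ∀ w, Z w ∈ P := fun Z hΘZ w =>
    (hP _).2 (by rw [← Module.End.mul_apply, hΘZ])
  have hle4 : ∀ B' : Module.End ℂ W, Θ * B' = B' → Module.finrank ℂ (LinearMap.range B') ≤ 4 := fun B' h => by
    rw [← hP4]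
    exact Submodule.finrank_mono (by rintro _ ⟨w, rfl⟩; exact hraiseval B' h w)
  have honto : ∀ B' : Module.End ℂ W, Θ * B' = B' → 4 ≤ Module.finrank ℂ (LinearMap.range B') →
      ∀ p ∈ P, ∃ w, B' w = p := by
    intro B' hΘB' h4 p hp
    have hle : LinearMap.range B' ≤ P := by rintro _ ⟨w, rfl⟩; exact hraiseval B' hΘB' w
    have heq : LinearMap.range B' = P := Submodule.eq_of_le_of_finrank_le hle (by rw [hP4]; exact h4)
    have hp' : p ∈ LinearMap.range B' := heq ▸ hp
    exact hp'
  obtain ⟨k, hk⟩ := hQodd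
  have hup : ∀ B' ∈ 𝔊, Θ * B' = B' → B' * Θ = -B' →
      (Module.finrank ℂ (LinearMap.range B') = 2 ∨ Module.finrank ℂ (LinearMap.range B') = 3) →
      ∃ B'' ∈ 𝔊, Θ * B'' = B'' ∧ B'' * Θ = -B'' ∧
        Module.finrank ℂ (LinearMap.range B') < Module.finrank ℂ (LinearMap.range B'') := by
    intro B' hB' hΘB' hB'Θ hr
    rcases hr with h2 | h3
    · refine UnitaryRaisingRank.exists_raise_rank_gt_of_two_le hbr hirr hΘ hΘΘ hP hQ hadd hsymm hPQ hdefP hdefQ hadj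
        hB' hΘB' hB'Θ (by omega) (by omega) (by omega) fun U 𝔩 ι P' Q' hbr𝔩 hirr𝔩 hι hιι hP' hQ' hfinP' hfinQ' hP'Q'
          hdefP' hdefQ' hadj𝔩 => ?_
      have hodd : Odd (Module.finrank ℂ Q') := ⟨k - 1, by omega⟩
      exact UnitaryTwoOdd.eq_top hbr𝔩 hirr𝔩 hι hιι hP' hQ' (by rw [hfinP', h2]) hodd
        (s := fun x y : U => s (x : W) y) (fun x y z => by simp only [Submodule.coe_add, hadd])
          (fun x y => hsymm x y) hP'Q' hdefP' hdefQ' hadj𝔩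
    · by_cases h3dvd : 3 ∣ Module.finrank ℂ Q
      · -- Ψ-route: `dim Q > 3 + C(3,2) = 6` since `b` is odd, `3 ∣ b`, `b ≥ 5`
        obtain ⟨m, hm⟩ := h3dvd
        have hc : (Module.finrank ℂ (LinearMap.range B')).choose 2 = 3 := by rw [h3]; decide
        exact UnitaryRaisingRank.exists_raise_rank_gt_of_finrank_eq_succ hbr hirr hΘ hΘΘ hP hQ hB' hΘB' hB'Θ
          (by omega) (by rw [h3, hP4]) (by rw [hc]; omega) hadd hsymm hPQ hdefP hdefQ hadj
      · refine UnitaryRaisingRank.exists_raise_rank_gt_of_two_le hbr hirr hΘ hΘΘ hP hQ hadd hsymm hPQ hdefP hdefQ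
          hadj hB' hΘB' hB'Θ (by omega) (by omega) (by omega) fun U 𝔩 ι P' Q' hbr𝔩 hirr𝔩 hι hιι hP' hQ' hfinP' hfinQ'
            hP'Q' hdefP' hdefQ' hadj𝔩 => ?_
        have h3' : ¬ 3 ∣ Module.finrank ℂ Q' := by omega
        exact UnitaryThreeCoprime.eq_top hbr𝔩 hirr𝔩 hι hιι hP' hQ' (by rw [hfinP', h3]) h3'
          (s := fun x y : U => s (x : W) y) (fun x y z => by simp only [Submodule.coe_add, hadd])
          (fun x y => hsymm x y) hP'Q' hdefP' hdefQ' hadj𝔩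
  obtain ⟨B₂, hB₂, hΘB₂, hB₂Θ, hrk₂⟩ :=
    UnitaryThreeCoprime.exists_raise_rank_ge_two hbr hirr hΘ hΘΘ hP hQ (by omega) (by omega)
  have h₂ := hle4 B₂ hΘB₂
  by_cases h4 : 4 ≤ Module.finrank ℂ (LinearMap.range B₂)
  · exact ⟨B₂, hB₂, hΘB₂, hB₂Θ, honto B₂ hΘB₂ h4⟩
  obtain ⟨B₃, hB₃, hΘB₃, hB₃Θ, hrk₃⟩ := hup B₂ hB₂ hΘB₂ hB₂Θ (by omega)
  have h₃ := hle4 B₃ hΘB₃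
  by_cases h4' : 4 ≤ Module.finrank ℂ (LinearMap.range B₃)
  · exact ⟨B₃, hB₃, hΘB₃, hB₃Θ, honto B₃ hΘB₃ h4'⟩
  obtain ⟨B₄, hB₄, hΘB₄, hB₄Θ, hrk₄⟩ := hup B₃ hB₃ hΘB₃ hB₃Θ (by omega)
  have h₄ := hle4 B₄ hΘB₄
  exact ⟨B₄, hB₄, hΘB₄, hB₄Θ, honto B₄ hΘB₄ (by omega)⟩

end RankFour

/-! ### §2 The `(4 | odd)` core -/

section Main

variable {W : Type*} [AddCommGroup W] [Module ℂ W]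

universe u in
/-- The induction behind `UnitaryFourOdd.eq_top` (strong induction on `dim Q`, the type `W` generalized; base cases
`(4|1)` — the pure `(m,1)` core — and `(4|3)` — `UnitaryThreeCoprime.eq_top'`; step by
`UnitaryCoprimeStep.eq_top_of_onto_of_core` with the rank-four raising lemma). [cite: Ribet1983, Thm. 3]
[cite: Gordon1997, §6 (proof of Thm. 6.3.3, pp. 18–19)] -/
private theorem UnitaryFourOdd.eq_top_aux (b : ℕ) :
    ∀ {W : Type u} [AddCommGroup W] [Module ℂ W] [FiniteDimensional ℂ W]
      {𝔊 : Submodule ℂ (Module.End ℂ W)},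
      (∀ Y ∈ 𝔊, ∀ Z ∈ 𝔊, Y * Z - Z * Y ∈ 𝔊) →
      (∀ U : Submodule ℂ W, (∀ A ∈ 𝔊, ∀ u ∈ U, A u ∈ U) → U = ⊥ ∨ U = ⊤) →
      ∀ {Θ : Module.End ℂ W}, Θ ∈ 𝔊 → Θ * Θ = 1 →
      ∀ {P Q : Submodule ℂ W}, (∀ x, x ∈ P ↔ Θ x = x) → (∀ x, x ∈ Q ↔ Θ x = -x) →
      Module.finrank ℂ P = 4 → Module.finrank ℂ Q = b → Odd b →
      ∀ {s : W → W → ℂ}, (∀ x y z, s (x + y) z = s x z + s y z) →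
      (∀ x y, s y x = starRingEnd ℂ (s x y)) →
      (∀ p ∈ P, ∀ q ∈ Q, s p q = 0) → (∀ p ∈ P, s p p = 0 → p = 0) → (∀ q ∈ Q, s q q = 0 → q = 0) →
      (∀ X ∈ 𝔊, ∃ Y ∈ 𝔊, ∀ x y, s (X x) y = s x (Y y)) → 𝔊 = ⊤ := by
  induction b using Nat.strong_induction_on with
  | _ b ih =>
  intro W _ _ _ 𝔊 hbr hirr Θ hΘ hΘΘ P Q hP hQ hP4 hQb hbodd s hadd hsymm hPQ hdefP hdefQ hadj
  by_cases hb1 : b = 1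
  · exact UnitaryThreeCoprime.eq_top_of_finrank_eq_one hbr hirr hΘ hΘΘ hP hQ (by omega) (by rw [hQb, hb1])
  by_cases hb3 : b = 3
  · exact UnitaryThreeCoprime.eq_top' hbr hirr hΘ hΘΘ hP hQ (by rw [hP4]; omega) (by rw [hQb, hb3]) hadd hsymm hPQ
      hdefP hdefQ hadj
  have hb5 : 5 ≤ b := by obtain ⟨k, hk⟩ := hbodd; omega
  refine UnitaryCoprimeStep.eq_top_of_onto_of_core hbr hirr hΘ hΘΘ hP hQ hP4 hQb (by norm_num) (by omega) hadd hsymm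
    hPQ hdefP hdefQ hadj ?_ ?_
  · exact UnitaryFourOdd.exists_raise_onto_four hbr hirr hΘ hΘΘ hP hQ hP4 (by rw [hQb]; exact hbodd)
      (by rw [hQb]; exact hb5) hadd hsymm hPQ hdefP hdefQ hadj
  · intro 𝔩 ι P' Q' hbr𝔩 hirr𝔩 hι hιι hP' hQ' hfinP' hfinQ' hP'Q' hdefP' hdefQ' hadj𝔩
    have hodd' : Odd (b - 4) := by obtain ⟨k, hk⟩ := hbodd; exact ⟨k - 2, by omega⟩
    exact ih (b - 4) (by omega) hbr𝔩 hirr𝔩 hι hιι hP' hQ' hfinP' hfinQ' hodd' (s := fun x y : Q => s (x : W) y)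
      (fun x y z => by simp only [Submodule.coe_add, hadd]) (fun x y => hsymm x y) hP'Q' hdefP' hdefQ' hadj𝔩

/-- **THE `Θ`-SUBALGEBRA THEOREM FOR UNITARY MULTIPLICITIES `(4, b)`, `b` ODD — complex Hermitian core** (Ribet's
Thm. 3 at `(n′, n″) = (4, n″)` for all odd `n″`, classification-free). [cite: Ribet1983, Thm. 3]
[cite: Gordon1997, Thm. 6.3 (3) and pp. 18–19] [cite: Deligne1982HodgeCycles, I §3 Prop. 3.4, 3.6] -/
theorem UnitaryFourOdd.eq_top [FiniteDimensional ℂ W] {𝔊 : Submodule ℂ (Module.End ℂ W)}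
    (hbr : ∀ Y ∈ 𝔊, ∀ Z ∈ 𝔊, Y * Z - Z * Y ∈ 𝔊)
    (hirr : ∀ U : Submodule ℂ W, (∀ A ∈ 𝔊, ∀ u ∈ U, A u ∈ U) → U = ⊥ ∨ U = ⊤)
    {Θ : Module.End ℂ W} (hΘ : Θ ∈ 𝔊) (hΘΘ : Θ * Θ = 1)
    {P Q : Submodule ℂ W} (hP : ∀ x, x ∈ P ↔ Θ x = x) (hQ : ∀ x, x ∈ Q ↔ Θ x = -x)
    (hP4 : Module.finrank ℂ P = 4) (hQodd : Odd (Module.finrank ℂ Q))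
    {s : W → W → ℂ} (hadd : ∀ x y z, s (x + y) z = s x z + s y z) (hsymm : ∀ x y, s y x = starRingEnd ℂ (s x y))
    (hPQ : ∀ p ∈ P, ∀ q ∈ Q, s p q = 0) (hdefP : ∀ p ∈ P, s p p = 0 → p = 0) (hdefQ : ∀ q ∈ Q, s q q = 0 → q = 0)
    (hadj : ∀ X ∈ 𝔊, ∃ Y ∈ 𝔊, ∀ x y, s (X x) y = s x (Y y)) : 𝔊 = ⊤ :=
  UnitaryFourOdd.eq_top_aux _ hbr hirr hΘ hΘΘ hP hQ hP4 rfl hQodd hadd hsymm hPQ hdefP hdefQ hadj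

/-- **The mirror `(odd | 4)`** (apply `eq_top` to `−Θ`). [cite: Ribet1983, Thm. 3] [cite: Gordon1997, Thm. 6.3 (3)] -/
theorem UnitaryFourOdd.eq_top' [FiniteDimensional ℂ W] {𝔊 : Submodule ℂ (Module.End ℂ W)}
    (hbr : ∀ Y ∈ 𝔊, ∀ Z ∈ 𝔊, Y * Z - Z * Y ∈ 𝔊)
    (hirr : ∀ U : Submodule ℂ W, (∀ A ∈ 𝔊, ∀ u ∈ U, A u ∈ U) → U = ⊥ ∨ U = ⊤)
    {Θ : Module.End ℂ W} (hΘ : Θ ∈ 𝔊) (hΘΘ : Θ * Θ = 1)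
    {P Q : Submodule ℂ W} (hP : ∀ x, x ∈ P ↔ Θ x = x) (hQ : ∀ x, x ∈ Q ↔ Θ x = -x)
    (hPodd : Odd (Module.finrank ℂ P)) (hQ4 : Module.finrank ℂ Q = 4)
    {s : W → W → ℂ} (hadd : ∀ x y z, s (x + y) z = s x z + s y z) (hsymm : ∀ x y, s y x = starRingEnd ℂ (s x y))
    (hPQ : ∀ p ∈ P, ∀ q ∈ Q, s p q = 0) (hdefP : ∀ p ∈ P, s p p = 0 → p = 0) (hdefQ : ∀ q ∈ Q, s q q = 0 → q = 0)
    (hadj : ∀ X ∈ 𝔊, ∃ Y ∈ 𝔊, ∀ x y, s (X x) y = s x (Y y)) : 𝔊 = ⊤ := by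
  have hnΘ : -Θ ∈ 𝔊 := Submodule.neg_mem _ hΘ
  have hnΘΘ : (-Θ) * (-Θ) = 1 := by rw [neg_mul_neg, hΘΘ]
  exact UnitaryFourOdd.eq_top hbr hirr hnΘ hnΘΘ (P := Q) (Q := P)
    (fun x => by rw [hQ, LinearMap.neg_apply, neg_eq_iff_eq_neg]) (fun x => by rw [hP, LinearMap.neg_apply, neg_inj])
    hQ4 hPodd hadd hsymm (fun q hq p hp => by rw [hsymm, hPQ p hp q hq, map_zero]) hdefQ hdefP hadj

end Main

end HodgeStructure

end Literature.AlgebraicGeometry.Motives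

end
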